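import Mathlib
import Summits.KontsevichZagierPeriods.KontsevichZagierPeriods.Theorems.InverseLandauTateFamilyKernelOpenCube
import Summits.KontsevichZagierPeriods.KontsevichZagierPeriods.Theorems.InverseLandauTateFamilyKernelTateAnchor
import Summits.KontsevichZagierPeriods.KontsevichZagierPeriods.Theorems.InverseLandauTateFamilyKernelStubExactFibreTwo
import Summits.KontsevichZagierPeriods.KontsevichZagierPeriods.Theorems.InverseLandauTateFamilyKernelStubSfEvenOdd
import Summits.KontsevichZagierPeriods.KontsevichZagierPeriods.Theorems.InverseLandauTateFamilyKernelStubSfMoments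
import Summits.KontsevichZagierPeriods.KontsevichZagierPeriods.Theorems.InverseLandauTateFamilyKernelStubSfDensity
import Summits.KontsevichZagierPeriods.KontsevichZagierPeriods.Theorems.InverseLandauTateFamilyKernelStubSfLogElim
import Summits.KontsevichZagierPeriods.KontsevichZagierPeriods.Theorems.InverseLandauTateFamilyKernelStubSfExact

/-!
# Crux `TateFamilyKernel` (stmt-KontsevichZagierPeriods-9130), line `Sketch` — the SYMMETRIC-FOLD LINEAR CLASS is a
proved sector (the first class where the symmetry kind (d) is essential)

`Q = 1 − ϖ z₁(1−z₁)(α + βz₂)` (`α, β ∈ ℚ_{>0}`), `P ∈ ℚ[z₁, z₂]`: admissibility and identical vanishing of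
`∫_{(0,1)²} P/Q(z,ϖ) dz` on `(0,b)` imply that every tame cube representation of every real-algebraic fibre is a
Kontsevich–Zagier relation. Odd part under `z₁ ↦ 1 − z₁`: a hyperoctahedral element (`stub_sfEvenOdd`); even part:
`stub_sfMoments` (p145539) → `stub_sfDensity` (p145560, conic density through the 2:1 fold) → `stub_sfLogElim`
(log of a rational function of the conic parameter is not rational ⇒ the residue of the polar curve at its puncture
vanishes ⇒ rational primitive) → `stub_sfExact` (p145653, dlog certificate `Jac(Γ̃,Q)/Q`) → `stub_exactFibreTwo`.
-/

noncomputable section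

open MeasureTheory Set MvPolynomial
open Literature.NumberTheory.Transcendental

namespace Summit.KontsevichZagierPeriods.InverseLandau.TateFamilyKernel.Descent

/-- **The symmetric-fold linear class is a proved sector of the research stub** (dimension 2; the first class with
the symmetry kind (d) essential): `Q = 1 − ϖ z₁(1−z₁)(α+βz₂)`, `0 < α`, `0 < β`, `P` `ϖ`-free:
`stub_sfEvenOdd` (odd part hyperoctahedral, even part:) → `stub_sfMoments` → `stub_sfDensity` → `stub_sfLogElim`
→ `stub_sfExact` → `stub_exactFibreTwo`. [cite: KontsevichZagier2001, §1.2] [cite: Baker1975, Thm. 2.1] -/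
theorem sfClass_mem_relations (α β : ℚ) (P : MvPolynomial (Fin 2) ℚ) (b : ℝ)
    (hα : 0 < α) (hβ : 0 < β)
    (hadm : ∀ (z : Fin 2 → ℝ) (ϖ : ℝ), (∀ t, z t ∈ Icc (0 : ℝ) 1) → ϖ ∈ Ioo 0 b →
      aeval (Fin.snoc z ϖ : Fin (2 + 1) → ℝ)
        (1 - X (Fin.last 2) * (X 0 * (1 - X 0)) * (C α + C β * X 1) : MvPolynomial (Fin (2 + 1)) ℚ) ≠ 0)
    (hvan : ∀ ϖ ∈ Ioo 0 b, ∫ z in Set.pi Set.univ (fun _ : Fin 2 => Ioo (0 : ℝ) 1),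
      aeval (Fin.snoc z ϖ : Fin (2 + 1) → ℝ) (rename Fin.castSucc P) /
        aeval (Fin.snoc z ϖ : Fin (2 + 1) → ℝ)
          (1 - X (Fin.last 2) * (X 0 * (1 - X 0)) * (C α + C β * X 1) : MvPolynomial (Fin (2 + 1)) ℚ) = 0)
    (ϖ₀ : ℝ) (halg : IsAlgebraic ℚ ϖ₀) (hϖ₀ : ϖ₀ ∈ Ioo 0 b)
    (Φ : KZ.IntegralRep 2) (hΦ : Φ.IsTameCube)
    (hΦi : ∀ z ∈ KZ.cube 2, Φ.integrand z =
      aeval (Fin.snoc z ϖ₀ : Fin (2 + 1) → ℝ) (rename Fin.castSucc P) /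
        aeval (Fin.snoc z ϖ₀ : Fin (2 + 1) → ℝ)
          (1 - X (Fin.last 2) * (X 0 * (1 - X 0)) * (C α + C β * X 1) : MvPolynomial (Fin (2 + 1)) ℚ)) :
    KZ.of Φ ∈ KZ.relations := by
  have hb : 0 < b := hϖ₀.1.trans hϖ₀.2
  obtain ⟨heven, hvanE, htransfer⟩ := stub_sfEvenOdd α β P b hadm hvan ϖ₀ halg hϖ₀
  set Pe : MvPolynomial (Fin 2) ℚ := C (1 / 2 : ℚ) * (P + aeval ![1 - X 0, X 1] P) with hPe
  have hmom := stub_sfMoments α β Pe b hα hβ hb hadm hvanE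
  have hden := stub_sfDensity α β Pe hα hβ heven hmom
  obtain ⟨k, R, hR⟩ := stub_sfLogElim α β Pe hα hβ heven hden
  have hQ : ∀ w ∈ KZ.cube 2, aeval (Fin.snoc w ϖ₀ : Fin (2 + 1) → ℝ)
      (1 - X (Fin.last 2) * (X 0 * (1 - X 0)) * (C α + C β * X 1) : MvPolynomial (Fin (2 + 1)) ℚ) ≠ 0 :=
    fun w hw => hadm w ϖ₀ (fun t => hw t) hϖ₀
  obtain ⟨K, i, A, Dn, hDn, hexact⟩ := stub_sfExact α β Pe hα hβ k R hR ϖ₀ halg hϖ₀.1 hQ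
  have hev : ∀ R : KZ.IntegralRep 2, R.IsTameCube →
      (∀ z ∈ KZ.cube 2, R.integrand z = aeval z Pe /
          aeval (Fin.snoc z ϖ₀ : Fin (2 + 1) → ℝ)
            (1 - X (Fin.last 2) * (X 0 * (1 - X 0)) * (C α + C β * X 1) : MvPolynomial (Fin (2 + 1)) ℚ)) →
      KZ.of R ∈ KZ.relations := fun R hR hRi =>
    stub_exactFibreTwo K i (rename Fin.castSucc Pe) _ A Dn ϖ₀ halg hQ hDn hexact (hvanE ϖ₀ hϖ₀) R hR
      (fun z hz => by
        have hsc : ((Fin.snoc z ϖ₀ : Fin (2 + 1) → ℝ) ∘ Fin.castSucc) = z :=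
          funext fun j => by simp [Function.comp, Fin.snoc_castSucc]
        rw [hRi z hz, MvPolynomial.aeval_rename, hsc])
  exact htransfer hev Φ hΦ (fun z hz => by
    have hsc : ((Fin.snoc z ϖ₀ : Fin (2 + 1) → ℝ) ∘ Fin.castSucc) = z :=
      funext fun j => by simp [Function.comp, Fin.snoc_castSucc]
    rw [hΦi z hz, MvPolynomial.aeval_rename, hsc])

/-- The symmetric-fold class in the crux's own binders (`n = 2`, open-cube representation).
[cite: KontsevichZagier2001, §1.2] -/
theorem sfClass_openCube_mem_relations (α β : ℚ) (P : MvPolynomial (Fin 2) ℚ) (b : ℝ)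
    (hα : 0 < α) (hβ : 0 < β)
    (hadm : ∀ (z : Fin 2 → ℝ) (ϖ : ℝ), (∀ t, z t ∈ Icc (0 : ℝ) 1) → ϖ ∈ Ioo 0 b →
      aeval (Fin.snoc z ϖ : Fin (2 + 1) → ℝ)
        (1 - X (Fin.last 2) * (X 0 * (1 - X 0)) * (C α + C β * X 1) : MvPolynomial (Fin (2 + 1)) ℚ) ≠ 0)
    (hvan : ∀ ϖ ∈ Ioo 0 b, ∫ z in Set.pi Set.univ (fun _ : Fin 2 => Ioo (0 : ℝ) 1),
      aeval (Fin.snoc z ϖ : Fin (2 + 1) → ℝ) (rename Fin.castSucc P) /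
        aeval (Fin.snoc z ϖ : Fin (2 + 1) → ℝ)
          (1 - X (Fin.last 2) * (X 0 * (1 - X 0)) * (C α + C β * X 1) : MvPolynomial (Fin (2 + 1)) ℚ) = 0)
    (ϖ₀ : ℝ) (halg : IsAlgebraic ℚ ϖ₀) (hϖ₀ : ϖ₀ ∈ Ioo 0 b)
    (r : KZ.IntegralRep 2) (hd : r.domain = Set.pi Set.univ (fun _ : Fin 2 => Ioo (0 : ℝ) 1))
    (hi : EqOn r.integrand (fun z => aeval (Fin.snoc z ϖ₀ : Fin (2 + 1) → ℝ) (rename Fin.castSucc P) /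
        aeval (Fin.snoc z ϖ₀ : Fin (2 + 1) → ℝ)
          (1 - X (Fin.last 2) * (X 0 * (1 - X 0)) * (C α + C β * X 1) : MvPolynomial (Fin (2 + 1)) ℚ))
        r.domain) :
    KZ.of r ∈ KZ.relations := by
  have hQ : ∀ w ∈ KZ.cube 2, aeval (Fin.snoc w ϖ₀ : Fin (2 + 1) → ℝ)
      (1 - X (Fin.last 2) * (X 0 * (1 - X 0)) * (C α + C β * X 1) : MvPolynomial (Fin (2 + 1)) ℚ) ≠ 0 :=
    fun w hw => hadm w ϖ₀ (fun t => hw t) hϖ₀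
  obtain ⟨Φ, hΦ, hΦi⟩ := exists_isTameCube_fibre (rename Fin.castSucc P) _ halg hQ
  have hΦrel : KZ.of Φ ∈ KZ.relations :=
    sfClass_mem_relations α β P b hα hβ hadm hvan ϖ₀ halg hϖ₀ Φ hΦ (fun z _ => by rw [hΦi])
  exact of_mem_relations_of_isTameCube hΦ hΦrel r hd (fun z hz => by rw [hΦi]; exact hi hz)

end Summit.KontsevichZagierPeriods.InverseLandau.TateFamilyKernel.Descent
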